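import Literature.MathematicalPhysics.QuantumLattice.SectorSpectrum
import HarnessLib

/-!
# Weak duality for state (moment / bootstrap) relaxations of ground-state problems

Topic `Literature/MathematicalPhysics/QuantumManyBody`. Everything here is PROVED; no named fact is
introduced. This is the abstract lemma behind every "quantum many-body bootstrap" / variational
reduced-density-matrix / non-commutative sum-of-squares LOWER bound on a ground-state energy, in
the form in which a rounded, exactly checked dual certificate is used:

* the primal side (Han 2020, §2, eq. (1)–(3); Barthel–Hübener 2012; Mazziotti's `p`-positivity):
  for a linear functional `ω` on a complex `⋆`-algebra with `ω(a⋆a) ≥ 0`, the MOMENT MATRIX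
  `[ω(Oᵢ⋆ Oⱼ)]ᵢⱼ` of any finite family of operators is positive semidefinite
  (`posSemidef_stateMoments`; hermiticity of `ω` on such products follows from positivity alone,
  `map_star_mul_symm`);
* the dual side (Rubin–Low–DePrince 2026, eqs. (1), (10)–(12); Kull–Schuch–Dive–Navascués 2024,
  §5.3): a positive semidefinite Gram matrix `Λ` makes `ω(Σᵢⱼ Λᵢⱼ Oᵢ⋆Oⱼ) ≥ 0`
  (`map_gramForm_nonneg`), so an operator identity `h − c·1 = Σᵢⱼ Λᵢⱼ Oᵢ⋆Oⱼ + n` with `ω(n) = 0`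
  and `ω(1) = 1` certifies `c ≤ Re ω(h)` (`le_re_map_of_certificate`), and the `ε`-ROBUST version
  used to absorb solver / rounding error into the constant (`Λ + ε·1 ⪰ 0`,
  `Re ω(Oᵢ⋆Oᵢ) ≤ βᵢ` ⇒ `c − ε Σ βᵢ ≤ Re ω(h)`, `le_re_map_of_certificate_shift`) — KSDN §5.3;
* the finite-dimensional instances that turn such certificates into eigenvalue bounds: for a
  Hermitian matrix `A`, null terms may be commutators `A X − X A` ("`⟨[H,O]⟩ = 0`", energy
  eigenstates) and symmetry defects `U Y Uᴴ − Y` for unitaries commuting with `A` (translation /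
  point-group invariance), evaluated in the tracial ground state `Matrix.groundStateFunctional`
  (`groundEnergy_ge_of_certificate`); for a single eigenvector `A v = E v` (sector ground states,
  `sector_groundState`), null terms may in addition contain `Y Z + Z' Y'` with `Z v = 0`,
  `Z'ᴴ v = 0` — e.g. `Z = Z' = N̂ − N` fixing a particle-number sector — giving `c ≤ E`
  (`eigenvalue_ge_of_certificate`, `minEnergyOn_ge_of_certificate`).

The point of the abstract formulation is that ONE identity check in the operator algebra plus ONE
exact positive-semidefiniteness check (`Literature.Analysis.ValidatedNumerics.PSDCert.ldltCheck`)
is a proof of a lower bound, whatever numerical method produced `Λ`.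

## References
* X. Han, *Quantum many-body bootstrap*, arXiv:2006.06002 (2020), §2. [cite: Han2020Bootstrap, §2]
* N. C. Rubin, G. H. Low, A. E. DePrince III, *Near-frustration-free electronic structure Hamiltonian
  representations and lower bound certificates*, arXiv:2602.05069 (2026), §II. [cite: RubinLowDePrince2026, §II]
* I. Kull, N. Schuch, B. Dive, M. Navascués, *Lower bounding ground-state energies of local
  Hamiltonians through the renormalization group*, Phys. Rev. X 14 (2024) 021008, §5.3.
  [cite: KullEtAl2024, §5.3]
* T. Barthel, R. Hübener, Phys. Rev. Lett. 108 (2012) 200404. [cite: BarthelHubener2012]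
* S. Pironio, M. Navascués, A. Acín, SIAM J. Optim. 20 (2010) 2157 (NPA hierarchy: moment matrices
  of positive functionals). [folklore]
-/

noncomputable section

open Matrix Finset
open scoped ComplexOrder MatrixOrder BigOperators

namespace Literature.MathematicalPhysics.QuantumManyBody.StateRelaxation

/-! ### Abstract `⋆`-algebra: Gram elements, moment matrices, weak duality -/

section Abstract

variable {𝓐 : Type*} [Ring 𝓐] [StarRing 𝓐] [Algebra ℂ 𝓐] [StarModule ℂ 𝓐]
variable {m : Type*} [Fintype m]

/-- The Gram ("weighted sum of hermitian squares") element `Σᵢⱼ Λᵢⱼ • (Oᵢ⋆ Oⱼ)` of a coefficient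
matrix `Λ` and a finite family of operators `O`. For `Λ ⪰ 0` it is a sum of hermitian squares
(Rubin–Low–DePrince 2026, eq. (11): `o† G o`). [cite: RubinLowDePrince2026, §II eq. (11)] -/
def gramForm (Λ : Matrix m m ℂ) (O : m → 𝓐) : 𝓐 := ∑ i, ∑ j, Λ i j • (star (O i) * O j)

/-- The moment matrix `[ω(Oᵢ⋆ Oⱼ)]ᵢⱼ` of a linear functional on a finite family of operators
(Han 2020, eq. (1)–(2); Pironio–Navascués–Acín 2010). [cite: Han2020Bootstrap, §2 eq. (2)] -/
def stateMoments (ω : 𝓐 →ₗ[ℂ] ℂ) (O : m → 𝓐) : Matrix m m ℂ :=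
  Matrix.of fun i j => ω (star (O i) * O j)

omit [StarModule ℂ 𝓐] [Fintype m] in
/-- Entries of the moment matrix. [folklore] -/
@[simp] theorem stateMoments_apply (ω : 𝓐 →ₗ[ℂ] ℂ) (O : m → 𝓐) (i j : m) :
    stateMoments ω O i j = ω (star (O i) * O j) := rfl

omit [StarModule ℂ 𝓐] in
/-- `ω` of a Gram element is the entrywise pairing of `Λ` with the moment matrix. [folklore] -/
theorem map_gramForm (ω : 𝓐 →ₗ[ℂ] ℂ) (Λ : Matrix m m ℂ) (O : m → 𝓐) :
    ω (gramForm Λ O) = ∑ i, ∑ j, Λ i j * ω (star (O i) * O j) := by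
  simp [gramForm, map_sum, smul_eq_mul]

omit [StarModule ℂ 𝓐] in
/-- Additivity of the Gram element in the coefficient matrix. [folklore] -/
theorem gramForm_add (Λ Λ' : Matrix m m ℂ) (O : m → 𝓐) :
    gramForm (Λ + Λ') O = gramForm Λ O + gramForm Λ' O := by
  simp [gramForm, add_smul, Finset.sum_add_distrib]

omit [StarModule ℂ 𝓐] in
/-- The Gram element of `ε·1` is `ε Σᵢ Oᵢ⋆Oᵢ`. [folklore] -/
theorem gramForm_smul_one [DecidableEq m] (ε : ℂ) (O : m → 𝓐) :
    gramForm (ε • (1 : Matrix m m ℂ)) O = ε • ∑ i, star (O i) * O i := by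
  unfold gramForm
  have h : ∀ i j : m, ((ε • (1 : Matrix m m ℂ)) i j) • (star (O i) * O j) =
      if i = j then ε • (star (O i) * O j) else 0 := by
    intro i j
    by_cases hij : i = j
    · subst hij; simp
    · simp [Matrix.one_apply_ne hij, hij]
  simp_rw [h, Finset.sum_ite_eq, Finset.mem_univ, if_true, Finset.smul_sum]

/-- `(Σⱼ vⱼ Oⱼ)⋆ = Σⱼ v̄ⱼ Oⱼ⋆`. [folklore] -/
theorem star_lincomb (v : m → ℂ) (O : m → 𝓐) :
    star (∑ j, v j • O j) = ∑ j, star (v j) • star (O j) := by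
  rw [star_sum]
  exact Finset.sum_congr rfl fun j _ => star_smul (v j) (O j)

/-- Expansion of `ω((Σᵢ vᵢOᵢ)⋆ (Σⱼ wⱼOⱼ))` in moments. [folklore] -/
theorem map_star_lincomb_mul_lincomb (ω : 𝓐 →ₗ[ℂ] ℂ) (O : m → 𝓐) (v w : m → ℂ) :
    ω (star (∑ i, v i • O i) * ∑ j, w j • O j) =
      ∑ i, ∑ j, star (v i) * w j * ω (star (O i) * O j) := by
  rw [star_lincomb, Finset.sum_mul]
  simp_rw [Finset.mul_sum, smul_mul_smul_comm, map_sum, map_smul, smul_eq_mul]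

/-- The quadratic form of the moment matrix is `ω` of a hermitian square:
`v⋆ M v = ω(p⋆ p)`, `p = Σⱼ vⱼ Oⱼ`. [cite: Han2020Bootstrap, §2] -/
theorem stateMoments_quadForm (ω : 𝓐 →ₗ[ℂ] ℂ) (O : m → 𝓐) (v : m → ℂ) :
    star v ⬝ᵥ (stateMoments ω O *ᵥ v) = ω (star (∑ i, v i • O i) * ∑ j, v j • O j) := by
  rw [map_star_lincomb_mul_lincomb]
  simp only [dotProduct, mulVec, stateMoments_apply, Pi.star_apply, Finset.mul_sum]
  exact Finset.sum_congr rfl fun i _ => Finset.sum_congr rfl fun j _ => by ring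

omit [Fintype m] in
/-- **Hermiticity from positivity** (polarisation): if `ω(a⋆a) ≥ 0` for all `a`, then
`ω(y⋆x) = conj ω(x⋆y)`. Bratteli–Robinson I, Lemma 2.3.10. [folklore] -/
theorem map_star_mul_symm (ω : 𝓐 →ₗ[ℂ] ℂ) (hpos : ∀ a, 0 ≤ ω (star a * a)) (x y : 𝓐) :
    ω (star y * x) = star (ω (star x * y)) := by
  set a := ω (star x * y) with ha
  set b := ω (star y * x) with hb
  have hP : (ω (star x * x)).im = 0 := ((Complex.nonneg_iff.mp (hpos x)).2).symm
  have hQ : (ω (star y * y)).im = 0 := ((Complex.nonneg_iff.mp (hpos y)).2).symm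
  -- `ω((x+y)⋆(x+y)) = P + a + b + Q`
  have h1 : ω (star (x + y) * (x + y)) = ω (star x * x) + a + b + ω (star y * y) := by
    simp only [star_add, add_mul, mul_add, map_add, ha, hb]; ring
  -- `ω((x+iy)⋆(x+iy)) = P + i a - i b + Q`
  have h2 : ω (star (x + Complex.I • y) * (x + Complex.I • y)) =
      ω (star x * x) + Complex.I * a - Complex.I * b + ω (star y * y) := by
    have hI : star (Complex.I • y) = (-Complex.I) • star y := by
      rw [star_smul, Complex.star_def, Complex.conj_I]
    simp only [star_add, hI, add_mul, mul_add, smul_mul_assoc, mul_smul_comm, map_add,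
      map_smul, smul_eq_mul, ha, hb]
    linear_combination (-(ω (star y * y))) * Complex.I_mul_I
  have i1 : (ω (star x * x) + a + b + ω (star y * y)).im = 0 := by
    rw [← h1]; exact ((Complex.nonneg_iff.mp (hpos (x + y))).2).symm
  have i2 : (ω (star x * x) + Complex.I * a - Complex.I * b + ω (star y * y)).im = 0 := by
    rw [← h2]; exact ((Complex.nonneg_iff.mp (hpos (x + Complex.I • y))).2).symm
  simp only [Complex.add_im, Complex.sub_im, Complex.mul_im, Complex.I_re, Complex.I_im, zero_mul,
    one_mul, zero_add, hP, hQ, add_zero] at i1 i2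
  apply Complex.ext
  · rw [Complex.star_def, Complex.conj_re]; linarith
  · rw [Complex.star_def, Complex.conj_im]; linarith

/-- **Positive functionals have positive semidefinite moment matrices** (the primal constraint of
every moment / bootstrap / `p`-positivity relaxation). Han 2020, §2, eq. (1)–(2); Pironio–
Navascués–Acín 2010, Lemma 5. [cite: Han2020Bootstrap, §2] -/
theorem posSemidef_stateMoments (ω : 𝓐 →ₗ[ℂ] ℂ) (hpos : ∀ a, 0 ≤ ω (star a * a)) (O : m → 𝓐) :
    (stateMoments ω O).PosSemidef := by
  refine PosSemidef.of_dotProduct_mulVec_nonneg ?_ fun v => ?_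
  · ext i j
    rw [conjTranspose_apply, stateMoments_apply, stateMoments_apply, ← map_star_mul_symm ω hpos]
  · rw [stateMoments_quadForm]
    exact hpos _

/-- **A positive semidefinite Gram element is nonnegative in every positive functional**
(`Λ = Bᴴ B` makes `Σ Λᵢⱼ Oᵢ⋆Oⱼ = Σₖ pₖ⋆pₖ`, `pₖ = Σⱼ Bₖⱼ Oⱼ`). Rubin–Low–DePrince 2026 eq. (1);
KSDN 2024 §5.3 ("any feasible point of the dual … gives a lower bound").
[cite: RubinLowDePrince2026, §II eq. (1)] -/
theorem map_gramForm_nonneg [DecidableEq m] (ω : 𝓐 →ₗ[ℂ] ℂ) (hpos : ∀ a, 0 ≤ ω (star a * a))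
    {Λ : Matrix m m ℂ} (hΛ : Λ.PosSemidef) (O : m → 𝓐) : 0 ≤ ω (gramForm Λ O) := by
  obtain ⟨B, hB⟩ := CStarAlgebra.nonneg_iff_eq_star_mul_self.mp hΛ.nonneg
  have hprod : ∀ i j : m, Λ i j = ∑ k, star (B k i) * B k j := by
    intro i j
    rw [hB, Matrix.star_eq_conjTranspose, Matrix.mul_apply]
    exact Finset.sum_congr rfl fun k _ => by rw [conjTranspose_apply]
  have key : ω (gramForm Λ O) = ∑ k, ω (star (∑ i, B k i • O i) * ∑ j, B k j • O j) := by
    simp_rw [map_star_lincomb_mul_lincomb, map_gramForm, hprod, Finset.sum_mul]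
    exact (Finset.sum_congr rfl fun i _ => Finset.sum_comm).trans Finset.sum_comm
  rw [key]
  exact Finset.sum_nonneg fun k _ => hpos _

omit [StarModule ℂ 𝓐] in
/-- Bookkeeping: `ω(h) = c + ω(gram)` from the certificate identity. [folklore] -/
theorem map_eq_of_certificate (ω : 𝓐 →ₗ[ℂ] ℂ) (hone : ω 1 = 1) (Λ : Matrix m m ℂ) (O : m → 𝓐)
    {h n : 𝓐} (hn : ω n = 0) {c : ℝ} (hcert : h - (c : ℂ) • (1 : 𝓐) = gramForm Λ O + n) :
    ω h = c + ω (gramForm Λ O) := by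
  have := congrArg ω hcert
  rw [map_sub, map_smul, hone, map_add, hn, add_zero, smul_eq_mul, mul_one] at this
  linear_combination this

/-- **Weak duality / certificate lemma.** If `ω` is positive and normalised, and
`h − c·1 = Σᵢⱼ Λᵢⱼ Oᵢ⋆Oⱼ + n` with `Λ ⪰ 0` and `ω(n) = 0`, then `c ≤ Re ω(h)` (and `ω(h)` is real,
`im_map_of_certificate`). This is `E₀ ≥ E_lb` of Han 2020 eq. (3) read through the dual, and
Rubin–Low–DePrince 2026 eq. (10)–(12) with an ideal term `n`. [cite: Han2020Bootstrap, §2 eq. (3)] -/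
theorem le_re_map_of_certificate [DecidableEq m] (ω : 𝓐 →ₗ[ℂ] ℂ)
    (hpos : ∀ a, 0 ≤ ω (star a * a)) (hone : ω 1 = 1) {Λ : Matrix m m ℂ} (hΛ : Λ.PosSemidef)
    (O : m → 𝓐) {h n : 𝓐} (hn : ω n = 0) {c : ℝ}
    (hcert : h - (c : ℂ) • (1 : 𝓐) = gramForm Λ O + n) : c ≤ (ω h).re := by
  obtain ⟨hre, -⟩ := Complex.nonneg_iff.mp (map_gramForm_nonneg ω hpos hΛ O)
  rw [map_eq_of_certificate ω hone Λ O hn hcert, Complex.add_re, Complex.ofReal_re]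
  linarith

/-- Under the hypotheses of `le_re_map_of_certificate`, `ω(h)` is real. [folklore] -/
theorem im_map_of_certificate [DecidableEq m] (ω : 𝓐 →ₗ[ℂ] ℂ)
    (hpos : ∀ a, 0 ≤ ω (star a * a)) (hone : ω 1 = 1) {Λ : Matrix m m ℂ} (hΛ : Λ.PosSemidef)
    (O : m → 𝓐) {h n : 𝓐} (hn : ω n = 0) {c : ℝ}
    (hcert : h - (c : ℂ) • (1 : 𝓐) = gramForm Λ O + n) : (ω h).im = 0 := by
  obtain ⟨-, him⟩ := Complex.nonneg_iff.mp (map_gramForm_nonneg ω hpos hΛ O)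
  rw [map_eq_of_certificate ω hone Λ O hn hcert, Complex.add_im, Complex.ofReal_im, ← him, add_zero]

/-- **`ε`-robust certificate** (absorbing solver / rounding error into the constant, KSDN 2024
§5.3): if only `Λ + ε·1 ⪰ 0` (`ε ≥ 0`) and the diagonal moments are bounded, `Re ω(Oᵢ⋆Oᵢ) ≤ βᵢ`
(e.g. `βᵢ = ‖Oᵢ‖²`, `= 1` for fermion or Pauli strings), then
`h − c·1 = Σᵢⱼ Λᵢⱼ Oᵢ⋆Oⱼ + n`, `ω(n) = 0` still give `c − ε Σᵢ βᵢ ≤ Re ω(h)`.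
[cite: KullEtAl2024, §5.3] -/
theorem le_re_map_of_certificate_shift [DecidableEq m] (ω : 𝓐 →ₗ[ℂ] ℂ)
    (hpos : ∀ a, 0 ≤ ω (star a * a)) (hone : ω 1 = 1) {Λ : Matrix m m ℂ} {ε : ℝ}
    (hΛε : (Λ + (ε : ℂ) • (1 : Matrix m m ℂ)).PosSemidef) (O : m → 𝓐) {β : m → ℝ}
    (hβ : ∀ i, (ω (star (O i) * O i)).re ≤ β i) (hε : 0 ≤ ε) {h n : 𝓐} (hn : ω n = 0) {c : ℝ}
    (hcert : h - (c : ℂ) • (1 : 𝓐) = gramForm Λ O + n) :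
    c - ε * ∑ i, β i ≤ (ω h).re := by
  have hg := map_gramForm_nonneg ω hpos hΛε O
  rw [gramForm_add, gramForm_smul_one, map_add, map_smul, map_sum, smul_eq_mul] at hg
  obtain ⟨hre, -⟩ := Complex.nonneg_iff.mp hg
  rw [Complex.add_re, Complex.re_ofReal_mul, Complex.re_sum] at hre
  have hsum : ∑ i, (ω (star (O i) * O i)).re ≤ ∑ i, β i := Finset.sum_le_sum fun i _ => hβ i
  rw [map_eq_of_certificate ω hone Λ O hn hcert, Complex.add_re, Complex.ofReal_re]
  nlinarith [mul_le_mul_of_nonneg_left hsum hε]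

/-- **Certificate with an explicit residual** (the form a ROUNDED certificate takes: exact identity
`h − c·1 = Σᵢⱼ Λᵢⱼ Oᵢ⋆Oⱼ + n + r` with a small residual `r` whose expectation is bounded below,
`−ε ≤ Re ω(r)`, e.g. by `Σ|coeff|` over monomials of norm at most one): `c − ε ≤ Re ω(h)`.
KSDN 2024 §5.3. [cite: KullEtAl2024, §5.3] -/
theorem le_re_map_of_certificate_residual [DecidableEq m] (ω : 𝓐 →ₗ[ℂ] ℂ)
    (hpos : ∀ a, 0 ≤ ω (star a * a)) (hone : ω 1 = 1) {Λ : Matrix m m ℂ} (hΛ : Λ.PosSemidef)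
    (O : m → 𝓐) {h n r : 𝓐} (hn : ω n = 0) {ε : ℝ} (hr : -ε ≤ (ω r).re) {c : ℝ}
    (hcert : h - (c : ℂ) • (1 : 𝓐) = gramForm Λ O + n + r) : c - ε ≤ (ω h).re := by
  obtain ⟨hre, -⟩ := Complex.nonneg_iff.mp (map_gramForm_nonneg ω hpos hΛ O)
  have hωh : ω h = c + ω (gramForm Λ O) + ω r := by
    have := congrArg ω hcert
    rw [map_sub, map_smul, hone, map_add, map_add, hn, add_zero, smul_eq_mul, mul_one] at this
    linear_combination this
  rw [hωh, Complex.add_re, Complex.add_re, Complex.ofReal_re]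
  linarith

omit [StarRing 𝓐] [StarModule ℂ 𝓐] in
/-- Termwise residual bound: if `r = Σₖ aₖ • Mₖ` and each term satisfies `−‖aₖ‖ ≤ Re (aₖ ω(Mₖ))`
(e.g. `ω` a vector state and `Mₖ` a contraction, `Matrix.IsContraction.neg_norm_mul_le`), then
`−Σₖ ‖aₖ‖ ≤ Re ω(r)`. [folklore] -/
theorem neg_sum_norm_le_re_map_sum {κ : Type*} (s : Finset κ) (ω : 𝓐 →ₗ[ℂ] ℂ) (a : κ → ℂ)
    (M : κ → 𝓐) (hterm : ∀ k ∈ s, -‖a k‖ ≤ (a k * ω (M k)).re) :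
    -(∑ k ∈ s, ‖a k‖) ≤ (ω (∑ k ∈ s, a k • M k)).re := by
  rw [map_sum, Complex.re_sum, ← Finset.sum_neg_distrib]
  refine Finset.sum_le_sum fun k hk => ?_
  rw [map_smul, smul_eq_mul]
  exact hterm k hk

end Abstract

/-! ### Matrix instances: tracial ground state and eigenvector states -/

section MatrixInstances

variable {n : Type*} [Fintype n] [DecidableEq n]
variable {m : Type*} [Fintype m] [DecidableEq m]

/-- **Bootstrap certificate ⇒ ground-energy lower bound (all sectors).** For a Hermitian matrix
`A` on a nonempty index type: an identity
`A − c·1 = Σᵢⱼ Λᵢⱼ Oᵢᴴ Oⱼ + Σₖ (A Xₖ − Xₖ A) + Σₗ (Uₗ Yₗ Uₗᴴ − Yₗ)` with `Λ ⪰ 0` and unitaries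
`Uₗ` commuting with `A` proves `c ≤ E₀(A)`: evaluate in the tracial ground state
(`Matrix.groundStateFunctional`), which is positive, normalised, kills commutators with `A`
(`ω(AX) = E₀ω(X) = ω(XA)`) and symmetry defects (`groundStateFunctional_conj_of_commute`), and
has `ω(A) = E₀`. This is the finite-volume form of Han 2020 eq. (2)–(3) with constraints
`⟨[H,O]⟩ = 0`, `⟨U⁻¹OU⟩ = ⟨O⟩`. [cite: Han2020Bootstrap, §2 eq. (2)–(3)] -/
theorem groundEnergy_ge_of_certificate [Nonempty n] {A : Matrix n n ℂ} (hA : A.IsHermitian)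
    {Λ : Matrix m m ℂ} (hΛ : Λ.PosSemidef) (O : m → Matrix n n ℂ)
    {κ : Type*} (s : Finset κ) (X : κ → Matrix n n ℂ)
    {ι : Type*} (t : Finset ι) (U Y : ι → Matrix n n ℂ)
    (hU : ∀ l ∈ t, U l * A = A * U l) (hUU : ∀ l ∈ t, (U l)ᴴ * U l = 1) {c : ℝ}
    (hcert : A - (c : ℂ) • (1 : Matrix n n ℂ) =
      gramForm Λ O + (∑ k ∈ s, (A * X k - X k * A) + ∑ l ∈ t, (U l * Y l * (U l)ᴴ - Y l))) :
    c ≤ A.groundEnergy := by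
  set ω := A.groundStateFunctional with hω
  have hpos : ∀ a : Matrix n n ℂ, 0 ≤ ω (star a * a) := fun a => by
    rw [hω, Matrix.star_eq_conjTranspose]; exact Matrix.groundStateFunctional_nonneg A a
  have hone : ω 1 = 1 := Matrix.groundStateFunctional_one hA
  have hnull : ω (∑ k ∈ s, (A * X k - X k * A) + ∑ l ∈ t, (U l * Y l * (U l)ᴴ - Y l)) = 0 := by
    rw [map_add, map_sum, map_sum]
    have h1 : ∀ k ∈ s, ω (A * X k - X k * A) = 0 := fun k _ => by
      rw [map_sub, hω, Matrix.groundStateFunctional_hamiltonian_mul hA,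
        Matrix.groundStateFunctional_mul_hamiltonian, sub_self]
    have h2 : ∀ l ∈ t, ω (U l * Y l * (U l)ᴴ - Y l) = 0 := fun l hl => by
      rw [map_sub, hω, Matrix.groundStateFunctional_conj_of_commute hA (hU l hl) (hUU l hl),
        sub_self]
    rw [Finset.sum_eq_zero h1, Finset.sum_eq_zero h2, add_zero]
  have h := le_re_map_of_certificate ω hpos hone hΛ O hnull hcert
  rwa [hω, Matrix.groundStateFunctional_hamiltonian hA, Complex.ofReal_re] at h

/-- The vector state `O ↦ ⟨v, O v⟩` of a vector `v`, as a linear functional on matrices.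
[folklore] -/
def vectorState (v : n → ℂ) : Matrix n n ℂ →ₗ[ℂ] ℂ where
  toFun O := star v ⬝ᵥ O *ᵥ v
  map_add' O O' := by simp only [add_mulVec, dotProduct_add]
  map_smul' c O := by simp only [smul_mulVec, dotProduct_smul, RingHom.id_apply]

omit [DecidableEq n] in
/-- Unfolding lemma for `vectorState`. [folklore] -/
@[simp] theorem vectorState_apply (v : n → ℂ) (O : Matrix n n ℂ) :
    vectorState v O = star v ⬝ᵥ O *ᵥ v := rfl

omit [DecidableEq n] in
/-- Vector states are positive: `⟨v, Oᴴ O v⟩ = ‖O v‖² ≥ 0`. [folklore] -/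
theorem vectorState_nonneg (v : n → ℂ) (O : Matrix n n ℂ) : 0 ≤ vectorState v (star O * O) := by
  rw [vectorState_apply, Matrix.star_eq_conjTranspose, ← mulVec_mulVec, dotProduct_mulVec,
    ← star_mulVec]
  exact dotProduct_star_self_nonneg _

omit [DecidableEq n] in
/-- For an eigenvector `A v = E v` of a Hermitian `A` (`E` real): `v⋆ A = E v⋆`. [folklore] -/
theorem star_vecMul_of_eigenvector {A : Matrix n n ℂ} (hA : A.IsHermitian) {E : ℝ} {v : n → ℂ}
    (hAv : A *ᵥ v = (E : ℂ) • v) : star v ᵥ* A = (E : ℂ) • star v := by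
  have h := star_mulVec A v
  rw [hA.eq, hAv, star_smul, Complex.star_def, Complex.conj_ofReal] at h
  exact h.symm

omit [DecidableEq n] in
/-- Energy eigenstates kill commutators with the Hamiltonian: `⟨v, (A X − X A) v⟩ = 0` for
`A v = E v`, `A` Hermitian (Han 2020, "`⟨[H,O]⟩ = 0`"). [cite: Han2020Bootstrap, §2] -/
theorem vectorState_commutator {A : Matrix n n ℂ} (hA : A.IsHermitian) {E : ℝ} {v : n → ℂ}
    (hAv : A *ᵥ v = (E : ℂ) • v) (X : Matrix n n ℂ) : vectorState v (A * X - X * A) = 0 := by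
  rw [vectorState_apply, sub_mulVec, dotProduct_sub, ← mulVec_mulVec, ← mulVec_mulVec, hAv,
    mulVec_smul, dotProduct_smul, dotProduct_mulVec, star_vecMul_of_eigenvector hA hAv,
    smul_dotProduct, sub_self]

omit [DecidableEq n] in
/-- Sector constraints: `⟨v, Y Z v⟩ = 0` if `Z v = 0`. [folklore] -/
theorem vectorState_mul_of_mulVec_eq_zero (v : n → ℂ) (Y : Matrix n n ℂ) {Z : Matrix n n ℂ}
    (hZ : Z *ᵥ v = 0) : vectorState v (Y * Z) = 0 := by
  rw [vectorState_apply, ← mulVec_mulVec, hZ, mulVec_zero, dotProduct_zero]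

omit [DecidableEq n] in
/-- Sector constraints: `⟨v, Z' Y v⟩ = 0` if `Z'ᴴ v = 0`. [folklore] -/
theorem vectorState_mul_of_conjTranspose_mulVec_eq_zero (v : n → ℂ) (Y : Matrix n n ℂ)
    {Z' : Matrix n n ℂ} (hZ' : Z'ᴴ *ᵥ v = 0) : vectorState v (Z' * Y) = 0 := by
  have h := star_mulVec Z'ᴴ v
  rw [conjTranspose_conjTranspose, hZ', star_zero] at h
  rw [vectorState_apply, ← mulVec_mulVec, dotProduct_mulVec, ← h, zero_dotProduct]

/-- **Bootstrap certificate ⇒ eigenvalue lower bound (sector version).** For a Hermitian `A` and a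
unit eigenvector `A v = E v`: an identity
`A − c·1 = Σᵢⱼ Λᵢⱼ Oᵢᴴ Oⱼ + Σₖ (A Xₖ − Xₖ A) + Σₗ (Yₗ Zₗ + Z'ₗ Y'ₗ)` with `Λ ⪰ 0`, `Zₗ v = 0`,
`Z'ₗᴴ v = 0` (e.g. `Zₗ = Z'ₗ = N̂ − N·1` on a particle-number sector; the weighted-SOS ideal
terms `r f + f† r` of Rubin–Low–DePrince 2026 §III.A) proves `c ≤ E`.
[cite: RubinLowDePrince2026, §III.A] -/
theorem eigenvalue_ge_of_certificate {A : Matrix n n ℂ} (hA : A.IsHermitian) {E : ℝ}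
    {v : n → ℂ} (hv : star v ⬝ᵥ v = 1) (hAv : A *ᵥ v = (E : ℂ) • v)
    {Λ : Matrix m m ℂ} (hΛ : Λ.PosSemidef) (O : m → Matrix n n ℂ)
    {κ : Type*} (s : Finset κ) (X : κ → Matrix n n ℂ)
    {ι : Type*} (t : Finset ι) (Y Z Z' Y' : ι → Matrix n n ℂ)
    (hZ : ∀ l ∈ t, Z l *ᵥ v = 0) (hZ' : ∀ l ∈ t, (Z' l)ᴴ *ᵥ v = 0) {c : ℝ}
    (hcert : A - (c : ℂ) • (1 : Matrix n n ℂ) =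
      gramForm Λ O + (∑ k ∈ s, (A * X k - X k * A) + ∑ l ∈ t, (Y l * Z l + Z' l * Y' l))) :
    c ≤ E := by
  set ω := vectorState v with hω
  have hpos : ∀ a : Matrix n n ℂ, 0 ≤ ω (star a * a) := fun a => vectorState_nonneg v a
  have hone : ω 1 = 1 := by rw [hω, vectorState_apply, one_mulVec, hv]
  have hnull : ω (∑ k ∈ s, (A * X k - X k * A) + ∑ l ∈ t, (Y l * Z l + Z' l * Y' l)) = 0 := by
    rw [map_add, map_sum, map_sum]
    have h1 : ∀ k ∈ s, ω (A * X k - X k * A) = 0 := fun k _ => vectorState_commutator hA hAv _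
    have h2 : ∀ l ∈ t, ω (Y l * Z l + Z' l * Y' l) = 0 := fun l hl => by
      rw [map_add, hω, vectorState_mul_of_mulVec_eq_zero v _ (hZ l hl),
        vectorState_mul_of_conjTranspose_mulVec_eq_zero v _ (hZ' l hl), add_zero]
    rw [Finset.sum_eq_zero h1, Finset.sum_eq_zero h2, add_zero]
  have h := le_re_map_of_certificate ω hpos hone hΛ O hnull hcert
  rwa [hω, vectorState_apply, hAv, dotProduct_smul, hv, smul_eq_mul, mul_one,
    Complex.ofReal_re] at h

/-- **Bootstrap certificate ⇒ sector ground-energy lower bound.** For a Hermitian `A` leaving a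
nonzero coordinate sector `K = {v | v i = 0 unless p i}` invariant, a certificate as in
`eigenvalue_ge_of_certificate` whose annihilators satisfy `Zₗ v = 0`, `Z'ₗᴴ v = 0` on all of `K`
proves `c ≤ minEnergyOn A K` (the sector energy is attained at an eigenvector in `K`,
`sector_groundState`). This is the shape of `HubbardWave0.groundEnergy H N` (particle-number
sector). [cite: Han2020Bootstrap, §2 eq. (3)] -/
theorem minEnergyOn_ge_of_certificate {A : Matrix n n ℂ} (hA : A.IsHermitian)
    (p : n → Prop) [DecidablePred p] (hp : ∃ i, p i) (hinv : ∀ i j, ¬ p i → p j → A i j = 0)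
    (K : Submodule ℂ (n → ℂ)) (hK : ∀ v, v ∈ K ↔ ∀ i, ¬ p i → v i = 0)
    {Λ : Matrix m m ℂ} (hΛ : Λ.PosSemidef) (O : m → Matrix n n ℂ)
    {κ : Type*} (s : Finset κ) (X : κ → Matrix n n ℂ)
    {ι : Type*} (t : Finset ι) (Y Z Z' Y' : ι → Matrix n n ℂ)
    (hZ : ∀ l ∈ t, ∀ v ∈ K, Z l *ᵥ v = 0) (hZ' : ∀ l ∈ t, ∀ v ∈ K, (Z' l)ᴴ *ᵥ v = 0) {c : ℝ}
    (hcert : A - (c : ℂ) • (1 : Matrix n n ℂ) =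
      gramForm Λ O + (∑ k ∈ s, (A * X k - X k * A) + ∑ l ∈ t, (Y l * Z l + Z' l * Y' l))) :
    c ≤ A.minEnergyOn K := by
  obtain ⟨⟨v, hvK, hv0, hAv⟩, -⟩ :=
    Literature.MathematicalPhysics.QuantumLattice.sector_groundState A hA p hp hinv K hK
  obtain ⟨a, -, ha1⟩ := Literature.MathematicalPhysics.QuantumLattice.exists_smul_unit hv0
  have hwK : a • v ∈ K := K.smul_mem a hvK
  have hAw : A *ᵥ (a • v) = ((A.minEnergyOn K : ℝ) : ℂ) • (a • v) := by
    rw [mulVec_smul, hAv, smul_comm]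
  exact eigenvalue_ge_of_certificate hA ha1 hAw hΛ O s X t Y Z Z' Y'
    (fun l hl => hZ l hl _ hwK) (fun l hl => hZ' l hl _ hwK) hcert

end MatrixInstances

end Literature.MathematicalPhysics.QuantumManyBody.StateRelaxation
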